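import Literature.MathematicalPhysics.QuantumFieldTheory.QCDOS
import Summits.QuantumFields.QCD.Theses.SpectralDefectExtinction
import Summits.QuantumFields.QCD.Theorems.NestedDissectionSeaThresholdShift

/-!
# `ThresholdForm` (stmt-QuantumFields-10433) — a QCD regularisation above a mass threshold is a QCD regularisation

Support item of route SpectralDefectExtinction (sub-problem `QCD`): if some mass-scaling regularisation
`reg` realises the body of `QCDOf N_f` (OS data along `reg.scheme m z shift`, non-trivial non-Gaussian glue,
dynamical quarks, one mass gap `Δ > 0` of the continuum data and of all lattice observables) for every mass
tuple `m` with `m_f > M₁` (`M₁ ≥ 0` a threshold), then some mass-scaling regularisation realises it for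
every mass tuple with `m_f > 0` — i.e. `QCDOf N_f`, written unfolded in the route file.

Proof: the threshold re-basing `thresholdShift_generic` (tree, Theorems/NestedDissectionSeaThresholdShift):
replace `m_crit(k)` by `m_crit(k) + a_k M₁ / Z_m(k)`; `HasMassScaling` only reads `a, Z_m` (unchanged), and
the re-based regularisation realises at `m` exactly the scheme the old one realises at `m + M₁`, where
`m_f + M₁ > M₁` whenever `m_f > 0`. The hypothesis `0 ≤ M₁` is not needed.
-/

namespace Summit.QuantumFields.QCD.Theorems

open Literature.MathematicalPhysics.QuantumFieldTheory

/-- **`ThresholdForm` holds** (item stmt-QuantumFields-10433 of route SpectralDefectExtinction, literally the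
route decl): for every `N_f`, if a mass-scaling regularisation `reg` realises the `QCDOf` body for all mass
tuples above a threshold `M₁ ≥ 0`, then the re-based regularisation (`m_crit(k) ↦ m_crit(k) + a_k M₁/Z_m(k)`,
same `a, β, L, Z_m`) realises it for all positive mass tuples: at masses `m > 0` it runs the scheme of `reg`
at `m + M₁ > M₁` (`thresholdShift_generic`), with the same species renormalisations `z, shift`, the same OS
data `T` and the same gap `Δ`. [folklore; cf. MontvayMunster1994 §5.1 (additive mass renormalisation of
Wilson fermions is flavour-blind)] -/
theorem thresholdForm_proof :
    Summit.QuantumFields.QCD.Theses.SpectralDefectExtinction.ThresholdForm := by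
  unfold Summit.QuantumFields.QCD.Theses.SpectralDefectExtinction.ThresholdForm
  rintro Nf ⟨reg, hms, M₁, -, h⟩
  obtain ⟨reg', hms', hsch⟩ := thresholdShift_generic Nf reg M₁
  refine ⟨reg', hms' hms, fun m hm => ?_⟩
  obtain ⟨z, shift, T, hT⟩ := h (fun f => m f + M₁) (fun f => lt_add_of_pos_left M₁ (hm f))
  exact ⟨z, shift, T, by rw [hsch]; exact hT⟩

end Summit.QuantumFields.QCD.Theorems
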